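import Summits.Schanuel.Schanuel.Theorems.EPiSimultaneousType.Negative.IrreducibleWitness
import Summits.Schanuel.Schanuel.Theorems.DiophantineDichotomyApproximationRace
import Literature.NumberTheory.Transcendental.ExpOneTranscendenceMeasureProofs

/-!
# `EPiSimultaneousType` holds with degree exponent `a = 2` — unconditionally
(positive layer of item stmt-Schanuel-6118, route `Schanuel/DiophantineDichotomy`; `--supports`)

The item `Summit.Schanuel.Schanuel.Theses.DiophantineDichotomy.EPiSimultaneousType` asks for a
simultaneous approximation measure of the pair `(π, e)`,
`‖γ − (π, e)‖ ≥ exp(−C(dᵃ log H + dᵇ))` for every algebraic challenger `γ ∈ ℂ²` of joint degree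
`≤ d` whose coordinates are roots of non-zero integer polynomials of degree `≤ d` and naive height
`≤ H`, with a degree exponent `a < 1` (open: it contains `e ⊥ π`,
`Theorems/DiophantineDichotomyEPiSimultaneousTypeStrength.lean`).

This file proves the SAME statement with `a < 1` weakened to `a ≤ 2` (witness `(a, b, C) =
(2, 3, 189063)`), unconditionally, from the transcendence measure for `e` of Nesterenko–Waldschmidt
1996 (Theorem 4 (1), PROVED in the tree:
`Literature.NumberTheory.Transcendental.NW1996.approx_measure_exp_one`, |e − ξ| ≥
exp(−63021·D²(D + ℓ)) for `ξ` of degree `D` with `log M(ξ) ≤ ℓ`), read on the `e`-coordinate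
alone:

* `EPiSimultaneousType.length_le_of_clause` — the clause at level `(d, H)` bounds the length
  `L(P) ≤ (d+1)H`;
* `EPiSimultaneousType.exp_one_sub_ge_of_clause` — the `e`-FLOOR in approximation form: if `z` is a
  root of a non-zero `P ∈ ℤ[X]` with `deg P ≤ d`, height `≤ H`, then
  `|e − z| ≥ exp(−63021 d²(2d + 1 + log H))` (pass to an irreducible factor `Q` of `P` vanishing at
  `z`, `log M(Q) ≤ log M(P) ≤ log L(P) ≤ log(d+1) + log H ≤ d + log H`, and apply N–W with
  `ℓ = d + 1 + log H`);
* `epiSimultaneousType_measure_two_three` — hence `‖γ − (π, e)‖ ≥ exp(−189063(d² log H + d³))`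
  for every challenger whose SECOND coordinate satisfies the clause (no joint-degree hypothesis);
* `epiSimultaneousType_shape_exponent_two` — the item's statement verbatim with `a < 1` replaced by
  `a ≤ 2` (REGISTERED stub on stmt-Schanuel-6118).

So, in the tree, the shape `exp(−C(dᵃ log H + dᵇ))` at `(π, e)` is: TRUE for `a ≥ 2` (this file,
unconditional, via `e`); IN PRINT but not yet proved in the tree for every `a > 1` (via `π`:
Nesterenko–Waldschmidt 1996 Thm 2, degree exponent `1 + o(1)` at ALL heights — named fact
`Literature.NumberTheory.Transcendental.NesterenkoWaldschmidt1996_thm_2_2`, reduced in the tree to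
their Main Theorem, `PiAlgebraicApproximationMeasure.lean`; for `e` alone no exponent `< 2` uniform
in the height is in print, cf. `Theorems/DiophantineDichotomyEPiSimultaneousTypeEFloor.lean`); not in
print for `a = 1`; open and `⊢ e ⊥ π` for `a < 1` (the item,
`Theorems/DiophantineDichotomyEPiSimultaneousTypeStrength.lean`); refuted for `a < 0` and for
`max(a, b) < 1/2` (`Theorems/EPiSimultaneousType/Negative/{NegExponentFalse, BoundedHeightHalf}.lean`).
Everything here is proved; no named facts; no `def`.
-/

-- `Summit.Schanuel.Schanuel.…` is the mandated summit/sub-problem namespace (single-conjunct summit), hence: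
set_option linter.dupNamespace false

noncomputable section

namespace Summit.Schanuel.Schanuel.Theorems

open Polynomial
open Summit.Schanuel.Schanuel.Theses.DiophantineDichotomy

namespace EPiSimultaneousType

/-- The clause at level `(d, H)` bounds the length: `L(P) = Σ_{k ≤ deg P} |a_k| ≤ (d + 1)·H`.
[folklore] -/
theorem length_le_of_clause {P : ℤ[X]} {d H : ℕ} (hdeg : P.natDegree ≤ d)
    (hH : ∀ k, |P.coeff k| ≤ (H : ℤ)) :
    (∑ k ∈ Finset.range (P.natDegree + 1), |(P.coeff k : ℝ)|) ≤ ((d : ℝ) + 1) * H := by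
  have hH0 : (0 : ℝ) ≤ H := Nat.cast_nonneg _
  calc (∑ k ∈ Finset.range (P.natDegree + 1), |(P.coeff k : ℝ)|)
      ≤ ∑ _k ∈ Finset.range (P.natDegree + 1), (H : ℝ) := by
        refine Finset.sum_le_sum fun k _ => ?_
        have h := hH k
        rw [← Int.cast_abs]
        exact_mod_cast h
    _ = ((P.natDegree : ℝ) + 1) * H := by
        rw [Finset.sum_const, Finset.card_range, nsmul_eq_mul]
        push_cast
        ring
    _ ≤ ((d : ℝ) + 1) * H := by
        have h : (P.natDegree : ℝ) ≤ d := by exact_mod_cast hdeg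
        nlinarith

/-- **The `e`-floor in approximation form (Nesterenko–Waldschmidt 1996, Thm 4 (1), in the naive
currency).** If `z ∈ ℂ` is a root of a non-zero `P ∈ ℤ[X]` with `deg P ≤ d` and all `|coeff| ≤ H`,
then `|e − z| ≥ exp(−63021 · d² · (2d + 1 + log H))`: apply the tree's
`NW1996.approx_measure_exp_one` to an irreducible factor `Q` of `P` vanishing at `z`
(`deg Q ≤ d`, `log M(Q) ≤ log M(P) ≤ log L(P) ≤ log((d+1)H) ≤ d + log H`) with
`ℓ = d + 1 + log H ≥ 1`. [cite: NesterenkoWaldschmidt1996, Theorem 4 (1)] -/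
theorem exp_one_sub_ge_of_clause {z : ℂ} {d H : ℕ}
    (h : ∃ P : Polynomial ℤ, P ≠ 0 ∧ P.natDegree ≤ d ∧ (∀ k, |P.coeff k| ≤ (H : ℤ)) ∧
      Polynomial.aeval z P = 0) :
    Real.exp (-(63021 * (d : ℝ) ^ 2 * (2 * d + 1 + Real.log H))) ≤ ‖(Real.exp 1 : ℂ) - z‖ := by
  obtain ⟨P, hP0, hdeg, hH, hroot⟩ := h
  have h1H : 1 ≤ H := ApproximationRace.one_le_height hP0 hH
  have hH1 : (1 : ℝ) ≤ H := by exact_mod_cast h1H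
  have hlogH : 0 ≤ Real.log H := Real.log_nonneg hH1
  have hd0 : (0 : ℝ) ≤ d := Nat.cast_nonneg _
  -- an irreducible factor of `P` vanishing at `z`
  obtain ⟨Q, hQirr, hQd, hQdvd, hQroot⟩ := exists_irreducible_dvd_aeval_eq_zero z P hP0 hroot
  have hQrat : Irreducible (Q.map (Int.castRingHom ℚ)) :=
    Literature.NumberTheory.Transcendental.NW1996.irreducible_map_rat_of_irreducible hQirr hQd
  have hDd : (Q.natDegree : ℝ) ≤ d := by
    exact_mod_cast (Polynomial.natDegree_le_of_dvd hQdvd hP0).trans hdeg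
  have hD0 : (0 : ℝ) ≤ Q.natDegree := Nat.cast_nonneg _
  -- Mahler measure of `Q`: `M(Q) ≤ M(P) ≤ L(P) ≤ (d+1) H`
  have hℓ1 : (1 : ℝ) ≤ (d : ℝ) + 1 + Real.log H := by linarith
  have hMQ : Real.log (Q.map (Int.castRingHom ℂ)).mahlerMeasure ≤ (d : ℝ) + 1 + Real.log H := by
    obtain ⟨R, hPQR⟩ := id hQdvd
    have hR : R ≠ 0 := by
      rintro rfl
      exact hP0 (by rw [hPQR, mul_zero])
    have hMQP : (Q.map (Int.castRingHom ℂ)).mahlerMeasure ≤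
        (P.map (Int.castRingHom ℂ)).mahlerMeasure := by
      have h := Literature.NumberTheory.Transcendental.NW1996.mahlerMeasure_le_of_mul (q := Q) hR
      rwa [← hPQR] at h
    have hMPL := Literature.NumberTheory.Transcendental.NW1996.mahlerMeasure_map_le_length P
    have hL := length_le_of_clause hdeg hH
    have hMQpos : 0 < (Q.map (Int.castRingHom ℂ)).mahlerMeasure :=
      lt_of_lt_of_le one_pos
        (Literature.NumberTheory.Transcendental.NW1996.one_le_mahlerMeasure_map hQirr.ne_zero)
    have hbound : (Q.map (Int.castRingHom ℂ)).mahlerMeasure ≤ ((d : ℝ) + 1) * H :=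
      hMQP.trans (hMPL.trans hL)
    have hd1pos : (0 : ℝ) < (d : ℝ) + 1 := by linarith
    have hHpos : (0 : ℝ) < H := by linarith
    calc Real.log (Q.map (Int.castRingHom ℂ)).mahlerMeasure
        ≤ Real.log (((d : ℝ) + 1) * H) := Real.log_le_log hMQpos hbound
      _ = Real.log ((d : ℝ) + 1) + Real.log H := Real.log_mul hd1pos.ne' hHpos.ne'
      _ ≤ (d : ℝ) + 1 + Real.log H := by
          have h := Real.log_le_sub_one_of_pos hd1pos
          linarith
  -- Nesterenko–Waldschmidt 1996, Theorem 4 (1)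
  have hNW := Literature.NumberTheory.Transcendental.NW1996.approx_measure_exp_one hQrat hQroot hℓ1 hMQ
  rw [Complex.ofReal_exp, Complex.ofReal_one]
  refine le_trans ?_ hNW
  rw [Real.exp_le_exp, neg_le_neg_iff]
  have h1 : (Q.natDegree : ℝ) ^ 2 ≤ (d : ℝ) ^ 2 := pow_le_pow_left₀ hD0 hDd 2
  have h2 : (Q.natDegree : ℝ) + ((d : ℝ) + 1 + Real.log H) ≤ d + ((d : ℝ) + 1 + Real.log H) := by
    linarith
  calc 63021 * (Q.natDegree : ℝ) ^ 2 * (Q.natDegree + ((d : ℝ) + 1 + Real.log H))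
      ≤ 63021 * (d : ℝ) ^ 2 * (d + ((d : ℝ) + 1 + Real.log H)) := by
        apply mul_le_mul (mul_le_mul_of_nonneg_left h1 (by norm_num)) h2 (by linarith)
          (by positivity)
    _ = 63021 * (d : ℝ) ^ 2 * (2 * d + 1 + Real.log H) := by ring

end EPiSimultaneousType

/-- **A simultaneous approximation measure for `(π, e)` with degree exponent `2`.** For every
`γ ∈ ℂ²` whose second coordinate is a root of a non-zero integer polynomial of degree `≤ d` and naive
height `≤ H`: `‖γ − (π, e)‖ ≥ exp(−189063·(d² log H + d³))` (sup norm; the `e`-coordinate alone,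
by `EPiSimultaneousType.exp_one_sub_ge_of_clause`, `d ≥ 1`, `log H ≥ 0`).
[cite: NesterenkoWaldschmidt1996, Theorem 4 (1)] -/
theorem epiSimultaneousType_measure_two_three {d H : ℕ} {γ : Fin 2 → ℂ}
    (hcl : ∃ P : Polynomial ℤ, P ≠ 0 ∧ P.natDegree ≤ d ∧ (∀ k, |P.coeff k| ≤ (H : ℤ)) ∧
      Polynomial.aeval (γ 1) P = 0) :
    Real.exp (-(189063 * ((d : ℝ) ^ 2 * Real.log H + (d : ℝ) ^ 3))) ≤
      ‖γ - ![(Real.pi : ℂ), (Real.exp 1 : ℂ)]‖ := by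
  obtain ⟨P, hP0, hdeg, hH, hroot⟩ := hcl
  have h1d : 1 ≤ d := ApproximationRace.one_le_of_root hP0 hdeg hroot
  have h1H : 1 ≤ H := ApproximationRace.one_le_height hP0 hH
  have hd1 : (1 : ℝ) ≤ d := by exact_mod_cast h1d
  have hH1 : (1 : ℝ) ≤ H := by exact_mod_cast h1H
  have hlogH : 0 ≤ Real.log H := Real.log_nonneg hH1
  have hfloor := EPiSimultaneousType.exp_one_sub_ge_of_clause ⟨P, hP0, hdeg, hH, hroot⟩
  -- the sup norm dominates the second coordinate
  have hcomp : ‖(Real.exp 1 : ℂ) - γ 1‖ ≤ ‖γ - ![(Real.pi : ℂ), (Real.exp 1 : ℂ)]‖ := by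
    calc ‖(Real.exp 1 : ℂ) - γ 1‖ = ‖γ 1 - (Real.exp 1 : ℂ)‖ := norm_sub_rev _ _
      _ = ‖(γ - ![(Real.pi : ℂ), (Real.exp 1 : ℂ)]) 1‖ := by simp
      _ ≤ ‖γ - ![(Real.pi : ℂ), (Real.exp 1 : ℂ)]‖ := norm_le_pi_norm _ 1
  refine le_trans ?_ (hfloor.trans hcomp)
  rw [Real.exp_le_exp, neg_le_neg_iff]
  have hd2 : (d : ℝ) ^ 2 ≤ (d : ℝ) ^ 3 := by nlinarith
  have hdl : 0 ≤ (d : ℝ) ^ 2 * Real.log H := mul_nonneg (sq_nonneg _) hlogH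
  nlinarith

/-- **Item stmt-Schanuel-6118 with degree exponent `a ≤ 2` instead of `a < 1` is a THEOREM**
(witness `(a, b, C) = (2, 3, 189063)`): for all `d, H` and all `γ ∈ ℂ²` with `[ℚ(γ):ℚ] ≤ d`
whose coordinates are roots of non-zero integer polynomials of degree `≤ d` and naive height `≤ H`,
`exp(−C(d² log H + d³)) ≤ ‖γ − (π, e)‖` — unconditionally, from the tree's proof of the
Nesterenko–Waldschmidt transcendence measure for `e` (`epiSimultaneousType_measure_two_three`;
the joint-degree and first-coordinate hypotheses are not used). The item itself asks for `a < 1`.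
[cite: NesterenkoWaldschmidt1996, Theorem 4 (1)] -/
theorem epiSimultaneousType_shape_exponent_two :
    ∃ a b C : ℝ, a ≤ 2 ∧ 0 < C ∧ ∀ (d H : ℕ) (γ : Fin 2 → ℂ),
      Module.finrank ℚ ↥(IntermediateField.adjoin ℚ (Set.range γ)) ≤ d →
      (∀ i, ∃ P : Polynomial ℤ, P ≠ 0 ∧ P.natDegree ≤ d ∧ (∀ k, |P.coeff k| ≤ (H : ℤ)) ∧
        Polynomial.aeval (γ i) P = 0) →
      Real.exp (-(C * ((d : ℝ) ^ a * Real.log H + (d : ℝ) ^ b))) ≤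
        ‖γ - ![(Real.pi : ℂ), (Real.exp 1 : ℂ)]‖ := by
  refine ⟨2, 3, 189063, le_rfl, by norm_num, fun d H γ _ hcl => ?_⟩
  have h3 : (d : ℝ) ^ (3 : ℝ) = (d : ℝ) ^ (3 : ℕ) := by exact_mod_cast Real.rpow_natCast (d : ℝ) 3
  rw [Real.rpow_two, h3]
  exact epiSimultaneousType_measure_two_three (hcl 1)

end Summit.Schanuel.Schanuel.Theorems

end
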